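import Mathlib.GroupTheory.FiniteAbelian.Basic
import Literature.NumberTheory.GaloisRepresentations.ProfiniteIntersectionTorsionCoefficients
import HarnessLib

/-!
# `H²(⋂ₖ Sₖ, D) = 0` for a discrete torsion module when finite-level classes die EVENTUALLY
# (deeper in the tower and in larger coefficients)

Topic `NumberTheory/GaloisRepresentations` (continuous cohomology of profinite groups); namespace
`Literature.NumberTheory.GaloisRepresentations`.  Theorems only (no definition, no named fact, no
instance; D-0026).

Let `G` be a profinite group (compact, Hausdorff, totally disconnected), `S₀ ⊇ S₁ ⊇ ⋯` a decreasing
sequence of closed subgroups with intersection `S_∞ = ⨅ₖ Sₖ`, and `D` a DISCRETE TORSION abelian group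
with the trivial action of every subgroup (`ContinuousRep.trivial`), over any commutative topological
coefficient ring `R` acting continuously on `D` (inert).  Serre's continuity of cohomology
(*Cohomologie galoisienne*, I §2.2 Prop. 8) reads
`H²(S_∞, D) = lim→_{k, A} H²(Sₖ, A)` over the stages `k` AND the finite subgroups `A ≤ D`; hence
`H²(S_∞, D)` vanishes as soon as every finite-level class dies EVENTUALLY in this double system:

* `subsingleton_H2_trivial_iInf_of_forall_exists_coboundary` — **cochain form, cofinal family**: let
  `F i ≤ D` (`i : ι`) be finite subgroups such that every finite subgroup of `D` lies in some `F i`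
  (e.g. `D[p^m]`, `m ≥ 0`, for `D ≃ ℚ_p/ℤ_p`).  If for every `k`, every `i` and every continuous
  `2`-cocycle `c` of `Sₖ` with values in `F i` there are `k' ≥ k` and a continuous `b : S_{k'} → D`
  with `c(σ, τ) = b(τ) − b(στ) + b(σ)` on `S_{k'}` (the cocycle becomes a `D`-valued coboundary
  deeper in the tower), then `H²(S_∞, D) = 0`;
* `subsingleton_H2_trivial_iInf_of_forall_exists_twoCocycleClass_eq_zero` — the same with the
  hypothesis in CLASS form: some `D`-valued continuous `2`-cocycle of `S_{k'}` agreeing valuewise with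
  the restriction of `c` has class `0` in `H²(S_{k'}, D)`;
* `subsingleton_H2_trivial_iInf_of_forall_finite_exists_coboundary` — the family of ALL finite
  subgroups.

The tree's `subsingleton_H2_trivial_iInf_of_forall` (`ProfiniteIntersectionTorsionCoefficients.lean`)
is the case `k' = k` with `H²(Sₖ, D) = 0` outright, and
`subsingleton_two_iInf_of_forall_exists_resSub_eq_zero` (`ProfiniteIntersectionCocycleExtension.lean`)
the case of FIXED finite coefficients; the present form is the one needed when neither holds — e.g.
for `Sₖ = Gal(K_S/F_k)` along the cyclotomic tower `F_k = K′(μ_{p^k})` and `D = ℚ_p/ℤ_p`, where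
`H²(G_S(F_k), ℚ_p/ℤ_p)` does NOT vanish at the finite layers (it measures the Leopoldt defect,
Neukirch–Schmidt–Wingberg (10.3.6)) but every `μ_{p^m}`-valued class dies after passing to a deeper
layer (the Brauer part, Tate) AND enlarging the coefficients `μ_{p^m} ↪ μ_{p^{m+t}}` (the `S`-ideal
class part), which is how Iwasawa's theorem "weak Leopoldt holds for the cyclotomic `ℤ_p`-extension"
(NSW (10.3.25)) is assembled.

Proof: a continuous `2`-cocycle `c : S_∞ × S_∞ → D` has finite image, so takes values in the finite
subgroup `⟨im c⟩ ≤ F i` for some `i`; as an `F i`-valued cocycle it extends to some `Sₖ` (the tree's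
`exists_cocycle_extension_of_iInf`), by hypothesis the extension is a `D`-valued coboundary `δb` on
some `S_{k'}`, and restricting `b` to `S_∞ ≤ S_{k'}` exhibits `c` as a coboundary.  HONEST FRAMING:
textbook profinite cohomology; nothing arithmetic is proved here.

## References

* J.-P. Serre, *Cohomologie galoisienne*, LNM 5 / *Galois Cohomology* (1997), I §2.2 Prop. 8 and
  Cor. 1, Cor. 2. [SerreGaloisCohomology1997]
* S. S. Shatz, *Profinite groups, arithmetic, and geometry* (1972), Ch. II §2. [Shatz1972]
* J. Neukirch, A. Schmidt, K. Wingberg, *Cohomology of Number Fields* (2008), (10.3.6), (10.3.25)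
  (the consumer). [NeukirchSchmidtWingberg2008]
-/

noncomputable section

open CategoryTheory Topology Filter

namespace Literature.NumberTheory.GaloisRepresentations

open _root_.TopRep _root_.ContRepresentation _root_.ContinuousCohomology

universe u

section Profinite

variable {G : Type u} [Group G] [TopologicalSpace G] [IsTopologicalGroup G] [CompactSpace G]
  [T2Space G] [TotallyDisconnectedSpace G]
variable {R : Type u} [CommRing R] [TopologicalSpace R] [IsTopologicalRing R]
variable {D : Type u} [AddCommGroup D] [Module R D] [TopologicalSpace D] [DiscreteTopology D]
  [ContinuousSMul R D]

omit [TotallyDisconnectedSpace G] [T2Space G] in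
/-- The subgroup generated by the values of a continuous map from a compact space to a discrete
torsion abelian group is finite (finite image; a finitely generated torsion abelian group is finite).
[folklore] -/
private theorem finite_closure_range_of_isTorsion (htors : AddMonoid.IsTorsion D) {X : Type*}
    [TopologicalSpace X] [CompactSpace X] (f : C(X, D)) :
    Finite (AddSubgroup.closure (Set.range f)) := by
  have hfin : (Set.range f).Finite := (isCompact_range f.continuous).finite_of_discrete
  haveI : Finite (Set.range f) := hfin.to_subtype
  haveI : AddGroup.FG (AddSubgroup.closure (Set.range f)) := AddGroup.closure_finite_fg _
  exact AddCommGroup.finite_of_fg_torsion _ (IsTorsion.addSubgroup htors _)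

omit [IsTopologicalRing R] in
/-- **`H²(⋂ₖ Sₖ, D) = 0` when every finite-level cocycle with values in a finite subgroup becomes a
`D`-valued coboundary deeper in the tower** (cochain form, over a cofinal family `F i` of finite
subgroups of the discrete torsion module `D` with the trivial action; any inert coefficient ring `R`):
the vanishing criterion extracted from `H²(⋂ Sₖ, D) = lim→_{k, A} H²(Sₖ, A)`.
[cite: SerreGaloisCohomology1997, I §2.2 Prop. 8, Cor. 1 and Cor. 2] [cite: Shatz1972, Ch. II §2] -/
theorem subsingleton_H2_trivial_iInf_of_forall_exists_coboundary (htors : AddMonoid.IsTorsion D)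
    {ι : Type*} (F : ι → AddSubgroup D) [hF : ∀ i, Finite (F i)]
    (hcof : ∀ A : AddSubgroup D, Finite A → ∃ i, A ≤ F i)
    (S : ℕ → Subgroup G) (hS : Antitone S) (hcl : ∀ k, IsClosed ((S k : Subgroup G) : Set G))
    (h : ∀ (k : ℕ) (i : ι)
      (c : contTwoCocycles
        (((ContinuousRep.trivial G ℤ (F i)).restrict (subgroupIncl (S k))).toTopRep)),
      ∃ (k' : ℕ) (hkk' : k ≤ k') (b : C(S k', D)), ∀ σ τ : S k',
        ((c.1 (Subgroup.inclusion (hS hkk') σ, Subgroup.inclusion (hS hkk') τ) : F i) : D) =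
          b τ - b (σ * τ) + b σ) :
    Subsingleton
      (continuousCohomology 2 (ContinuousRep.trivial (⨅ k, S k : Subgroup G) R D).toTopRep) := by
  classical
  have hcl' : IsClosed (((⨅ k, S k : Subgroup G)) : Set G) := by
    rw [Subgroup.coe_iInf]
    exact isClosed_iInter hcl
  -- closed subgroups of the compact `G` are compact (Hausdorff), hence locally compact
  haveI : CompactSpace (⨅ k, S k : Subgroup G) := isCompact_iff_compactSpace.mp hcl'.isCompact
  haveI : ∀ k, CompactSpace (S k) := fun k ↦ isCompact_iff_compactSpace.mp (hcl k).isCompact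
  refine subsingleton_of_forall_eq 0 fun x => ?_
  obtain ⟨c, rfl⟩ := twoCocycleClass_surjective _ x
  -- the finite subgroup `⟨im c⟩ ≤ D` lies in some `F i`
  haveI hAfin : Finite (AddSubgroup.closure (Set.range c.1)) :=
    finite_closure_range_of_isTorsion htors c.1
  obtain ⟨i, hi⟩ := hcof _ hAfin
  have hmem : ∀ q, c.1 q ∈ F i := fun q => hi (AddSubgroup.subset_closure ⟨q, rfl⟩)
  -- `c` as an `F i`-valued cocycle of the trivial `ℤ`-representation of `G` restricted to `S_∞`
  let ρA : ContinuousRep G ℤ (F i) := ContinuousRep.trivial G ℤ (F i)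
  let cA : contTwoCocycles ((ρA.restrict (subgroupIncl (⨅ k, S k))).toTopRep) :=
    ⟨⟨fun q => ⟨c.1 q, hmem q⟩, c.1.continuous.subtype_mk _⟩, fun σ τ υ => by
      apply Subtype.ext
      have hc := c.2 σ τ υ
      rw [ContinuousRep.toTopRep_ρ_apply, ContinuousRep.trivial_apply] at hc
      rw [ContinuousRep.toTopRep_ρ_apply, ContinuousRep.restrict_apply, subgroupIncl_apply,
        ContinuousRep.trivial_apply]
      simpa using hc⟩
  -- extend it to some `S k`
  obtain ⟨k, c', hc'⟩ := exists_cocycle_extension_of_iInf ρA S hS hcl cA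
  -- deeper in the tower the extension is a `D`-valued coboundary
  obtain ⟨k', hkk', b, hb⟩ := h k i c'
  -- restrict the splitting cochain to `S_∞ ≤ S k'`
  refine (twoCocycleClass_eq_zero_iff _ c).2 ⟨b.comp ⟨Subgroup.inclusion (iInf_le S k'),
    continuous_inclusion (iInf_le S k')⟩, fun σ τ => ?_⟩
  have h1 : c.1 (σ, τ) = ((cA.1 (σ, τ) : F i) : D) := rfl
  have h2 : cA.1 (σ, τ) = c'.1 (Subgroup.inclusion (hS hkk') (Subgroup.inclusion (iInf_le S k') σ),
      Subgroup.inclusion (hS hkk') (Subgroup.inclusion (iInf_le S k') τ)) := (hc' σ τ).symm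
  have h3 := hb (Subgroup.inclusion (iInf_le S k') σ) (Subgroup.inclusion (iInf_le S k') τ)
  rw [ContinuousRep.toTopRep_ρ_apply, ContinuousRep.trivial_apply, h1, h2, h3, ← map_mul]
  rfl

omit [IsTopologicalRing R] in
/-- **Class form**: `H²(⋂ₖ Sₖ, D) = 0` if every finite-level cocycle with values in a member of a
cofinal family of finite subgroups of `D` is, deeper in the tower, valuewise equal to a `D`-valued
continuous `2`-cocycle with class `0` (discrete torsion `D`, trivial action).
[cite: SerreGaloisCohomology1997, I §2.2 Prop. 8, Cor. 1 and Cor. 2] [cite: Shatz1972, Ch. II §2] -/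
theorem subsingleton_H2_trivial_iInf_of_forall_exists_twoCocycleClass_eq_zero
    (htors : AddMonoid.IsTorsion D)
    {ι : Type*} (F : ι → AddSubgroup D) [hF : ∀ i, Finite (F i)]
    (hcof : ∀ A : AddSubgroup D, Finite A → ∃ i, A ≤ F i)
    (S : ℕ → Subgroup G) (hS : Antitone S) (hcl : ∀ k, IsClosed ((S k : Subgroup G) : Set G))
    (h : ∀ (k : ℕ) (i : ι)
      (c : contTwoCocycles
        (((ContinuousRep.trivial G ℤ (F i)).restrict (subgroupIncl (S k))).toTopRep)),
      ∃ (k' : ℕ) (hkk' : k ≤ k')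
        (c'' : contTwoCocycles (ContinuousRep.trivial (S k') R D).toTopRep),
        (∀ σ τ : S k', c''.1 (σ, τ) =
          ((c.1 (Subgroup.inclusion (hS hkk') σ, Subgroup.inclusion (hS hkk') τ) : F i) : D)) ∧
        twoCocycleClass _ c'' = 0) :
    Subsingleton
      (continuousCohomology 2 (ContinuousRep.trivial (⨅ k, S k : Subgroup G) R D).toTopRep) := by
  haveI : ∀ k, CompactSpace (S k) := fun k ↦ isCompact_iff_compactSpace.mp (hcl k).isCompact
  refine subsingleton_H2_trivial_iInf_of_forall_exists_coboundary htors F hcof S hS hcl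
    fun k i c => ?_
  obtain ⟨k', hkk', c'', hc'', h0⟩ := h k i c
  obtain ⟨b, hb⟩ := (twoCocycleClass_eq_zero_iff _ c'').1 h0
  refine ⟨k', hkk', b, fun σ τ => ?_⟩
  have h3 := hb σ τ
  rw [ContinuousRep.toTopRep_ρ_apply, ContinuousRep.trivial_apply] at h3
  rw [← hc'' σ τ, h3]

omit [IsTopologicalRing R] in
/-- **All finite subgroups**: `H²(⋂ₖ Sₖ, D) = 0` if every finite-level cocycle with values in a
finite subgroup of `D` becomes a `D`-valued coboundary deeper in the tower (discrete torsion `D`,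
trivial action). [cite: SerreGaloisCohomology1997, I §2.2 Prop. 8, Cor. 1 and Cor. 2]
[cite: Shatz1972, Ch. II §2] -/
theorem subsingleton_H2_trivial_iInf_of_forall_finite_exists_coboundary
    (htors : AddMonoid.IsTorsion D)
    (S : ℕ → Subgroup G) (hS : Antitone S) (hcl : ∀ k, IsClosed ((S k : Subgroup G) : Set G))
    (h : ∀ (k : ℕ) (A : AddSubgroup D) [Finite A]
      (c : contTwoCocycles
        (((ContinuousRep.trivial G ℤ A).restrict (subgroupIncl (S k))).toTopRep)),
      ∃ (k' : ℕ) (hkk' : k ≤ k') (b : C(S k', D)), ∀ σ τ : S k',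
        ((c.1 (Subgroup.inclusion (hS hkk') σ, Subgroup.inclusion (hS hkk') τ) : A) : D) =
          b τ - b (σ * τ) + b σ) :
    Subsingleton
      (continuousCohomology 2 (ContinuousRep.trivial (⨅ k, S k : Subgroup G) R D).toTopRep) :=
  subsingleton_H2_trivial_iInf_of_forall_exists_coboundary htors
    (fun A : {A : AddSubgroup D // Finite A} => A.1) (hF := fun A => A.2)
    (fun A hA => ⟨⟨A, hA⟩, le_rfl⟩) S hS hcl fun k A c => @h k A.1 A.2 c

end Profinite

end Literature.NumberTheory.GaloisRepresentations

end
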